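import Literature.MathematicalPhysics.QuantumFieldTheory.CurvatureGaussianField
import Literature.Probability.LatticeModels.LatticeDirichletEnergy
import HarnessLib

/-!
# Stub `stub_kernelExact` of line `Sketch` (crux `stmt-QuantumFields-8760`)

Route `EquipartitionCriticality` of `YangMills`, crux item `stmt-QuantumFields-8760`
(`Summit.QuantumFields.YangMills.Theses.EquipartitionCriticality.EquipartitionPinsProbe`), line
`Sketch`, STUB K1 of the lead's skeleton.

What is proved: the two-plaquette kernel `T(q, p) = curvatureTwoPoint q p` of the lattice Maxwell
(curvature) Gaussian field on `ℤ⁴` fixes exact forms, `d* T = d*`: for every edge `(x, i)` and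
every plaquette `p`, the lattice co-derivative at `(x, i)` of the `2`-cochain `Y := T(·, p)`,
`(d*Y)(x, i) = ∑_{j>i} (Y(x; i,j) − Y(x−eⱼ; i,j)) + ∑_{j<i} (Y(x−eⱼ; j,i) − Y(x; j,i))`,
is the incidence number `[p : (x, i)] = (d δ_{(x,i)})_p ∈ {0, ±1}`.

Proof (valid in every dimension `d ≥ 3`, `KernelExact.codifferential_curvatureTwoPoint`):
by `curvatureTwoPoint_eq_plaquetteCurl`, `Y = dψ` for the `1`-cochain
`ψ e := plaquetteCurl (fun f => edgeGreen e f) p`. The `1`-form Hodge identity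
(`KernelExact.codifferential_plaquetteCurl`, pure algebra, any `1`-cochain `A`):
`(d* dA)(x, i) = −Δ(A(·, i))(x) + D A (x + eᵢ) − D A x` with the divergence
`D A y := ∑ⱼ (A(y, j) − A(y − eⱼ, j))`. For `A = ψ` the divergence vanishes identically
(`KernelExact.sum_curlGreen_sub_eq_zero`: the eight `edgeGreen` terms telescope), and
`−Δ ψ(·, i) (x) = ∑ₘ σₘ [∂ₘ p = (x, i)]` by linearity and the (translated) Poisson identity
`(−Δ) (latticeGreen (· − y) / 2) = δ_y` (`neg_latticeLaplacianZd_half_latticeGreen_sub`, from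
`latticeLaplacianZd_half_latticeGreen`), which is exactly `plaquetteCurl (indicator of (x, i)) p`.
-/

noncomputable section

open Literature.MathematicalPhysics.QuantumFieldTheory Literature.MathematicalPhysics.QuantumLattice
  Literature.Probability.LatticeModels

namespace Summit.QuantumFields.YangMills.Theorems.EquipartitionPinsProbe

namespace KernelExact

variable {d : ℕ}

/-- **Summand of the `1`-form Hodge identity.** For a `1`-cochain `A`, an edge `(x, i)` and a
direction `j`, the `j`-th summand of the co-derivative `(d* dA)(x, i)` equals
`(2A(x,i) − A(x+eⱼ,i) − A(x−eⱼ,i)) + ((A(x+eᵢ,j) − A(x+eᵢ−eⱼ,j)) − (A(x,j) − A(x−eⱼ,j)))`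
(both sides vanish for `j = i`). -/
theorem codifferential_plaquetteCurl_summand (A : ZdEdge d → ℝ) (x : Site d) (i j : Fin d) :
    (if hij : i < j then
        (plaquetteCurl A (x, ⟨(i, j), hij⟩) - plaquetteCurl A (x - Pi.single j 1, ⟨(i, j), hij⟩))
      else if hji : j < i then
        (plaquetteCurl A (x - Pi.single j 1, ⟨(j, i), hji⟩) - plaquetteCurl A (x, ⟨(j, i), hji⟩))
      else 0) =
      (2 * A (x, i) - A (x + Pi.single j 1, i) - A (x - Pi.single j 1, i)) +
        ((A (x + Pi.single i 1, j) - A (x + Pi.single i 1 - Pi.single j 1, j)) -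
          (A (x, j) - A (x - Pi.single j 1, j))) := by
  have h1 : x - Pi.single j 1 + Pi.single j 1 = x := sub_add_cancel x _
  have h2 : x - Pi.single j 1 + Pi.single i 1 = x + Pi.single i 1 - Pi.single j 1 :=
    sub_add_eq_add_sub x _ _
  split_ifs with hij hji
  · simp only [plaquetteCurl_eq, h1, h2]
    ring
  · simp only [plaquetteCurl_eq, h1, h2]
    ring
  · obtain rfl : i = j := le_antisymm (not_lt.1 hji) (not_lt.1 hij)
    rw [add_sub_cancel_right]
    ring

/-- **The `1`-form Hodge identity on `ℤ^d`** (`d* d = −Δ + d d*` componentwise): for every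
`1`-cochain `A` and every edge `(x, i)`,
`(d* dA)(x, i) = −Δ(A(·, i))(x) + (D A (x + eᵢ) − D A x)`, where
`D A y = ∑ⱼ (A(y, j) − A(y − eⱼ, j))` is the lattice divergence. -/
theorem codifferential_plaquetteCurl (A : ZdEdge d → ℝ) (x : Site d) (i : Fin d) :
    (∑ j : Fin d,
        if hij : i < j then
          (plaquetteCurl A (x, ⟨(i, j), hij⟩) - plaquetteCurl A (x - Pi.single j 1, ⟨(i, j), hij⟩))
        else if hji : j < i then
          (plaquetteCurl A (x - Pi.single j 1, ⟨(j, i), hji⟩) - plaquetteCurl A (x, ⟨(j, i), hji⟩))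
        else 0) =
      -latticeLaplacianZd (fun z => A (z, i)) x +
        ((∑ j : Fin d, (A (x + Pi.single i 1, j) - A (x + Pi.single i 1 - Pi.single j 1, j))) -
          ∑ j : Fin d, (A (x, j) - A (x - Pi.single j 1, j))) := by
  simp only [codifferential_plaquetteCurl_summand]
  simp only [Finset.sum_add_distrib, Finset.sum_sub_distrib, Finset.sum_const, Finset.card_univ,
    Fintype.card_fin, nsmul_eq_mul, latticeLaplacianZd]
  ring

/-- **The divergence of `ψ = Γ d* δ_p` vanishes**: for the `1`-cochain
`ψ e = plaquetteCurl (fun f => edgeGreen e f) p` and every site `y`,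
`∑ⱼ (ψ(y, j) − ψ(y − eⱼ, j)) = 0` (the eight `edgeGreen` terms telescope). -/
theorem sum_curlGreen_sub_eq_zero (p : ZdPlaquette d) (y : Site d) :
    ∑ j : Fin d, (plaquetteCurl (fun f => edgeGreen (y, j) f) p -
        plaquetteCurl (fun f => edgeGreen (y - Pi.single j 1, j) f) p) = 0 := by
  obtain ⟨w, ⟨a, b⟩, _⟩ := p
  simp only [plaquetteCurl_eq, edgeGreen_apply, Finset.sum_sub_distrib, Finset.sum_add_distrib,
    Finset.sum_ite_eq', Finset.mem_univ, if_true]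
  rw [show y - (w + Pi.single a 1) = y - Pi.single a 1 - w by abel,
    show y - (w + Pi.single b 1) = y - Pi.single b 1 - w by abel,
    show y - Pi.single b 1 - (w + Pi.single a 1) = y - Pi.single a 1 - (w + Pi.single b 1) by abel]
  ring

/-- The site Laplacian (acting on the first edge) commutes with the curl in the plaquette slot:
`Δ_z (d F(z, ·))_p = (d (Δ_z F(z, ·)))_p`. -/
theorem latticeLaplacianZd_plaquetteCurl (F : Site d → ZdEdge d → ℝ) (p : ZdPlaquette d)
    (x : Site d) :
    latticeLaplacianZd (fun z => plaquetteCurl (F z) p) x =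
      plaquetteCurl (fun e => latticeLaplacianZd (fun z => F z e) x) p := by
  simp only [plaquetteCurl_eq, latticeLaplacianZd, Finset.sum_add_distrib, Finset.sum_sub_distrib]
  ring

/-- **`−Δ` of the edge Green kernel is the identity kernel**: for `d ≥ 3`, every edge `(x, i)` and
every edge `f`, `−Δ_z Γ((z, i), f)` at `z = x` is `[f = (x, i)]`. -/
theorem neg_latticeLaplacianZd_edgeGreen (hd : 3 ≤ d) (x : Site d) (i : Fin d) (f : ZdEdge d) :
    -latticeLaplacianZd (fun z => edgeGreen (z, i) f) x = if f = (x, i) then 1 else 0 := by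
  obtain ⟨y, k⟩ := f
  by_cases hik : i = k
  · subst hik
    have h : (fun z : Site d => edgeGreen (z, i) (y, i)) = fun z => latticeGreen (z - y) / 2 := by
      funext z
      simp [edgeGreen]
    rw [h, neg_latticeLaplacianZd_half_latticeGreen_sub d hd y x]
    by_cases hxy : x = y
    · subst hxy
      simp
    · rw [if_neg hxy, if_neg]
      simp only [Prod.mk.injEq, and_true]
      exact Ne.symm hxy
  · have h : (fun z : Site d => edgeGreen (z, i) (y, k)) = fun _ => (0 : ℝ) := by
      funext z
      simp [edgeGreen, hik]
    rw [h, latticeLaplacianZd_const, neg_zero, if_neg]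
    simp only [Prod.mk.injEq, not_and]
    exact fun _ hki => hik hki.symm

/-- **`−Δ ψ(·, i) (x) = [p : (x, i)]`**: for `d ≥ 3`, the site Laplacian of
`z ↦ ψ(z, i) = plaquetteCurl (fun f => edgeGreen (z, i) f) p` at `x` is minus the incidence number
`(d δ_{(x,i)})_p = ∑ₘ σₘ [∂ₘ p = (x, i)]`. -/
theorem neg_latticeLaplacianZd_curlGreen (hd : 3 ≤ d) (p : ZdPlaquette d) (x : Site d)
    (i : Fin d) :
    -latticeLaplacianZd (fun z => plaquetteCurl (fun f => edgeGreen (z, i) f) p) x =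
      plaquetteCurl (fun e => if e = (x, i) then (1 : ℝ) else 0) p := by
  rw [latticeLaplacianZd_plaquetteCurl (fun z f => edgeGreen (z, i) f) p x]
  simp only [← neg_latticeLaplacianZd_edgeGreen hd x i, plaquetteCurl_eq]
  ring

/-- **`d* T = d*` in every dimension `d ≥ 3`**: the co-derivative at the edge `(x, i)` of the
`2`-cochain `q ↦ curvatureTwoPoint q p` is the incidence number `[p : (x, i)]`, i.e. the curl at
`p` of the indicator `1`-cochain of `(x, i)`. -/
theorem codifferential_curvatureTwoPoint (hd : 3 ≤ d) (x : Site d) (i : Fin d)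
    (p : ZdPlaquette d) :
    (∑ j : Fin d,
        if hij : i < j then
          (curvatureTwoPoint (x, ⟨(i, j), hij⟩) p -
            curvatureTwoPoint (x - Pi.single j 1, ⟨(i, j), hij⟩) p)
        else if hji : j < i then
          (curvatureTwoPoint (x - Pi.single j 1, ⟨(j, i), hji⟩) p -
            curvatureTwoPoint (x, ⟨(j, i), hji⟩) p)
        else 0) =
      plaquetteCurl (fun e => if e = (x, i) then (1 : ℝ) else 0) p := by
  simp only [curvatureTwoPoint_eq_plaquetteCurl]
  rw [codifferential_plaquetteCurl, sum_curlGreen_sub_eq_zero, sum_curlGreen_sub_eq_zero, sub_self,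
    add_zero]
  exact neg_latticeLaplacianZd_curlGreen hd p x i

end KernelExact

/-- STUB K1 — **the curvature kernel fixes exact forms** (`d* T = d*`): for every edge `(x, i)` of
`ℤ⁴` and every plaquette `p`, the lattice co-derivative at `(x, i)` of the `2`-cochain
`T(·, p) = curvatureTwoPoint · p`,
`∑_{j>i} (T((x;i,j),p) − T((x−eⱼ;i,j),p)) + ∑_{j<i} (T((x−eⱼ;j,i),p) − T((x;j,i),p))`, equals the
incidence number `[p : (x, i)] = (d δ_{(x,i)})_p` (`KernelExact.codifferential_curvatureTwoPoint`
at `d = 4`). -/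
theorem stub_kernelExact :
    ∀ (x : Literature.Probability.LatticeModels.Site 4) (i : Fin 4)
      (p : Literature.MathematicalPhysics.QuantumLattice.ZdPlaquette 4),
      (∑ j : Fin 4,
        if hij : i < j then
          (Literature.MathematicalPhysics.QuantumFieldTheory.curvatureTwoPoint (x, ⟨(i, j), hij⟩) p -
            Literature.MathematicalPhysics.QuantumFieldTheory.curvatureTwoPoint
              (x - Pi.single j 1, ⟨(i, j), hij⟩) p)
        else if hji : j < i then
          (Literature.MathematicalPhysics.QuantumFieldTheory.curvatureTwoPoint
              (x - Pi.single j 1, ⟨(j, i), hji⟩) p -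
            Literature.MathematicalPhysics.QuantumFieldTheory.curvatureTwoPoint (x, ⟨(j, i), hji⟩) p)
        else 0) =
      Literature.MathematicalPhysics.QuantumFieldTheory.plaquetteCurl
        (fun e => if e = (x, i) then (1 : ℝ) else 0) p :=
  fun x i p => KernelExact.codifferential_curvatureTwoPoint (by norm_num) x i p

end Summit.QuantumFields.YangMills.Theorems.EquipartitionPinsProbe

end
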